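/-
Copyright (c) 2026 the pub-hodgecm-mathlib formalisation cell (harness21).  Prover seat hodgecm-mathlib-K2E3-p26 (g0), Track B «K2-LIT» ∕ h413
(`stmt-HodgeConjecture-24833`), line `K2_E3_EllipticInputs`, (SC-an)₂ road «FC₂» (dealer K2E3-plan (g4) L4 EMIT #1, deal D134), letter COLL₂ of the assembly
`Theorems/K2E3FinConjAssemblyTwo.lean` ∕ `…SupercuspidalTruncatedCharAnalyticTwoOfLetters.lean` (K2E3-p23 (g7)) — FILE B of two (the torus and the HEAD).  2026-09-04.
-/
import Summits.HodgeConjecture.HodgeConjecture.Theorems.K2E3NearTriangularEigenvaluesTwo        -- FILE A (this seat): (6a₂) `exists_root_near_diagonal`, `trace_det_rel`, `sigma_root_mul_root_cases`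
import Summits.HodgeConjecture.HodgeConjecture.Theorems.K2E3NearSingularOfCompactCentralizer   -- ★ (FC-6b) scalar lemma `sigma_mul_ne_one_of_near_separated`; brings ★ FILE 1
                                                                                               --   `K2E3UnitaryAdjointIdempotent.adj_add ∕ adj_smul ∕ adj_one` (`Fin n`, `J² = 1`)
import Summits.HodgeConjecture.HodgeConjecture.Theorems.K2E3FinConjCartanCoverTwo               -- ★ F1₂ p861071 (this seat): `exists_forall_mem_v_apply_le_exp` (entry bound on a compact subset of `U`)
import HarnessLib

/-!
# Crux `H413` — K2-LIT E3, (SC-an)₂ road «FC₂», letter COLL₂ = brick (FC-6₂), FILE B — THE BOX LEMMA ON `U(σ, Φ₂)(K)`: `g` NEAR-LOWER-TRIANGULAR OF DEPTH `2d` WITH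
# COMPACT CENTRALISER HAS `exp(−k)`-CLOSE DIAGONAL ENTRIES (`5M + 4k + 2 ≤ d`)

Cell `hodgecm-mathlib`, Track B, line `K2_E3_EllipticInputs`, PART «SC» socket (SC-an)₂ `sig_K2E3SupercuspidalTruncatedCharAnalyticTwo` via the in-house road «FC₂»; seat
K2E3-p26 (g0), dealer K2E3-plan (g4) deal D134, binder desk K2E3-p23 (g7).  THEOREMS ONLY (no `def`, no `instance`, no notation, no named-fact hypothesis, no `sorry`);
count-neutral helper (`--supports stmt-HodgeConjecture-24833 --as helper`).  HEAD `exists_v_sub_lt_of_isCompact_centralizer` has EXACTLY the type of the binder `hCOLL` of ★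
`K2E3SupercuspidalTruncatedCharAnalyticTwoOfLetters` (∀-closed), i.e. the `Fin 2` twin of ★ (FC-6) `K2E3BoxCompactCentralizerCollision.exists_v_sub_lt_of_isCompact_centralizer`.
The N = 3 template composes ★ (FC-6a) `K2E3NearTriangularEigenvalues` and ★ (FC-6b) `K2E3NearSingularOfCompactCentralizer`, both `Fin 3`-typed (cubic characteristic
polynomial, Lagrange idempotents for three roots); the `2 × 2` twins are FILE A (eigenvalues, root involution) and this file (torus, head), reusing the generic parts by name.

THE MATHEMATICS (`K` non-archimedean local, `σ` an isometric involution, `ϖ` a uniformiser, `U = U(σ, Φ₂)(K)`, `g ∈ U` with matrix `A = [[a, b], [c, e]]`, all entries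
`≤ exp M`, `v(b) ≤ exp(M − 2d)`, `5M + 4k + 2 ≤ d`).  Suppose the diagonal is separated, `v(a − e) ≥ exp(−k)`.  FILE A gives the two eigenvalues `λ₀`, `λ₁ = a + e − λ₀`
in `K` (`v(λ₀ − a) ≤ exp(2M + k − 2d)`, `v(λ₀ − λ₁) = v(a − e)`) and `(σ(λ₀)λ₀ − 1)(σ(λ₀)λ₁ − 1) = 0`; the separated diagonal forces `σ(λ₀)λ₀ ≠ 1` (★ scalar lemma
`sigma_mul_ne_one_of_near_separated` with `g₂₂ ↦ g₁₁`, `v(σ(e)a − 1) = v(b)v(c) ≤ exp(2M − 2d)`), so **`σ(λ₀)·λ₁ = 1`**: the root involution SWAPS the eigenvalues.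
* §3 **the split torus in the centraliser**: `E₀ = (λ₀−λ₁)⁻¹(A − λ₁·1)`, `E₁ = 1 − E₀` are complementary idempotents commuting with `A` (`2 × 2` Cayley–Hamilton
  `(A − λ₁)(A − λ₀) = 0`), `A⁻¹ = λ₀⁻¹E₀ + λ₁⁻¹E₁`, and the swap gives `E₀⋆ = E₁` for the `σ`-adjoint `X⋆ = Φ₂ ᵗ(σX) Φ₂` (★ `adj_*`); hence `Y_t = t·E₀ + σ(t)⁻¹·E₁`
  satisfies `Y_t⋆ Y_t = 1`, i.e. `Y_t ∈ Z_U(g)` for every `t ∈ K^×`, with `(Y_t)₀₀ = t·(E₀)₀₀ + σ(t)⁻¹·(E₁)₀₀`.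
* §4 HEAD: `v((E₀)₀₀) = 1` and `v((E₁)₀₀) ≤ 1`, so `t = ϖ^{−(M′+1)}` gives `v((Y_t)₀₀) = exp(M′+1)`, exceeding the entry bound `exp M′` on the compact `Z_U(g)` (★ F1₂
  `exists_forall_mem_v_apply_le_exp`) — contradiction; so the diagonal is NOT separated.

HONEST LABEL: HC_CM is proved only modulo the 7 printed citations (2 remaining named inputs: hLiu418 = stmt-HodgeConjecture-24832, h413 =
stmt-HodgeConjecture-24833) until rung 0 closes; count-neutral; (SC-an)₂ is NOT ★ (REL over {COLL₂ (this file), NC₂, M5h₂} once the assembly's §B lands).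

## References
* [Rogawski1990] J. D. Rogawski, *Automorphic Representations of Unitary Groups in Three Variables*, Ann. of Math. Stud. 123 (1990), §1.9–§1.10 pp. 8–9, §3.5 p. 29, §3.6 pp. 31–32.
* [PlatonovRapinchuk1994] V. Platonov, A. Rapinchuk, *Algebraic Groups and Number Theory* (1994), §3.3 («anisotropic ⟺ compact»).
* [NeukirchANT1999] J. Neukirch, *Algebraic Number Theory* (1999), Ch. II §4 Lemma (4.6) (Hensel).
* [HarishChandra1970] Harish-Chandra (notes by G. van Dijk), *Harmonic Analysis on Reductive p-adic Groups*, LNM 162 (1970), Part VI §8 p. 60.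
-/

set_option autoImplicit false
-- the mandated namespace repeats `HodgeConjecture.HodgeConjecture`, as in every `Theorems/*.lean` of this sub-problem
set_option linter.dupNamespace false

noncomputable section

open Matrix
open scoped MatrixGroups WithZero
open Literature.NumberTheory.Automorphic Literature.NumberTheory.Automorphic.UnitaryGroup
open Summit.HodgeConjecture.HodgeConjecture.Cruxes.H413.K2E3UnitaryAdjointIdempotent
open Summit.HodgeConjecture.HodgeConjecture.Cruxes.H413.K2E3NearTriangularEigenvalues
open Summit.HodgeConjecture.HodgeConjecture.Cruxes.H413.K2E3NearTriangularEigenvaluesTwo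

namespace Summit.HodgeConjecture.HodgeConjecture.Cruxes.H413.K2E3BoxCompactCentralizerCollisionTwo

/-! ## §3 The split torus `Y_t = t·E₀ + σ(t)⁻¹·E₁` inside the centraliser -/

section Torus

variable {K : Type*} [Field K] (σ : K →+* K)

/-- **`2 × 2` Cayley–Hamilton, factored**: if `(λ₀ − a₀₀)(λ₀ − a₁₁) = a₀₁a₁₀` and `λ₀ + λ₁ = a₀₀ + a₁₁` then `(A − λ₁·1)(A − λ₀·1) = 0`. [folklore] -/
theorem sub_smul_one_mul_sub_smul_one_eq_zero (A : Matrix (Fin 2) (Fin 2) K) {l₀ l₁ : K}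
    (hroot : (l₀ - A 0 0) * (l₀ - A 1 1) = A 0 1 * A 1 0) (hsum : l₀ + l₁ = A 0 0 + A 1 1) :
    (A - l₁ • (1 : Matrix (Fin 2) (Fin 2) K)) * (A - l₀ • (1 : Matrix (Fin 2) (Fin 2) K)) = 0 := by
  ext i j
  fin_cases i <;> fin_cases j <;>
    simp only [Fin.zero_eta, Fin.mk_one, Fin.isValue, Matrix.mul_apply, Fin.sum_univ_two, Matrix.sub_apply, Matrix.smul_apply, Matrix.one_apply_eq,
      Matrix.one_apply_ne (show (0 : Fin 2) ≠ 1 by decide), Matrix.one_apply_ne (show (1 : Fin 2) ≠ 0 by decide), smul_eq_mul, mul_one, mul_zero,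
      sub_zero, Matrix.zero_apply]
  · linear_combination (-1 : K) * hroot - (A 0 0 - l₀) * hsum
  · linear_combination (-(A 0 1)) * hsum
  · linear_combination (-(A 1 0)) * hsum
  · linear_combination (-1 : K) * hroot - (A 1 1 - l₀) * hsum

/-- **(6b₂) THE SPLIT TORUS IN THE CENTRALISER.**  Let `g ∈ U(σ, Φ₂)(K)` have matrix `A`, and let `λ₀ ≠ λ₁` in `K` satisfy `(λ₀ − a₀₀)(λ₀ − a₁₁) = a₀₁a₁₀`,
`λ₀ + λ₁ = a₀₀ + a₁₁` (the two eigenvalues of `A`) and `σ(λ₀)·λ₁ = 1` (the root involution SWAPS them).  Then for every `t ∈ K^×` the centraliser `Z_U(g)` contains an element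
`Y_t` with `(Y_t)₀₀ = t·(E₀)₀₀ + σ(t)⁻¹·(E₁)₀₀`, `(E₀)₀₀ = (λ₀−λ₁)⁻¹(a₀₀ − λ₁)`, `(E₁)₀₀ = 1 − (E₀)₀₀`: namely `Y_t = t·E₀ + σ(t)⁻¹·E₁` for the complementary idempotents
`E₀ = (λ₀−λ₁)⁻¹(A − λ₁·1)`, `E₁ = 1 − E₀` (`A⁻¹ = λ₀⁻¹E₀ + λ₁⁻¹E₁`, and `E₀⋆ = E₁` for `X⋆ = Φ₂ ᵗ(σX) Φ₂` by the swap, so `Y_t⋆ Y_t = 1`).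
[cite: Rogawski1990, §3.6 pp. 31–32] [cite: PlatonovRapinchuk1994, §3.3] -/
theorem exists_mem_centralizer_apply_zero_zero (hσ : ∀ x, σ (σ x) = x) {J : Matrix (Fin 2) (Fin 2) K} (hJ : J = (StdForm.antidiagonal 2).over K)
    (g : ↥(unitaryGroupOfForm σ J)) {l₀ l₁ : K}
    (hroot : (l₀ - ((g : GL (Fin 2) K) : Matrix (Fin 2) (Fin 2) K) 0 0) * (l₀ - ((g : GL (Fin 2) K) : Matrix (Fin 2) (Fin 2) K) 1 1) =
      ((g : GL (Fin 2) K) : Matrix (Fin 2) (Fin 2) K) 0 1 * ((g : GL (Fin 2) K) : Matrix (Fin 2) (Fin 2) K) 1 0)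
    (hsum : l₀ + l₁ = ((g : GL (Fin 2) K) : Matrix (Fin 2) (Fin 2) K) 0 0 + ((g : GL (Fin 2) K) : Matrix (Fin 2) (Fin 2) K) 1 1)
    (hne : l₀ ≠ l₁) (hswap : σ l₀ * l₁ = 1) (t : K) (ht : t ≠ 0) :
    ∃ y ∈ Subgroup.centralizer ({g} : Set ↥(unitaryGroupOfForm σ J)),
      ((y : GL (Fin 2) K) : Matrix (Fin 2) (Fin 2) K) 0 0 =
        t * ((l₀ - l₁)⁻¹ * (((g : GL (Fin 2) K) : Matrix (Fin 2) (Fin 2) K) 0 0 - l₁)) +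
          (σ t)⁻¹ * (1 - (l₀ - l₁)⁻¹ * (((g : GL (Fin 2) K) : Matrix (Fin 2) (Fin 2) K) 0 0 - l₁)) := by
  subst hJ
  obtain ⟨Φ, hΦ⟩ : ∃ Φ : Matrix (Fin 2) (Fin 2) K, (StdForm.antidiagonal 2).over K = Φ := ⟨_, rfl⟩
  obtain ⟨A, hA⟩ : ∃ A : Matrix (Fin 2) (Fin 2) K, ((g : GL (Fin 2) K) : Matrix (Fin 2) (Fin 2) K) = A := ⟨_, rfl⟩
  rw [hA] at hroot hsum ⊢
  have hΦΦ : Φ * Φ = 1 := by rw [← hΦ]; exact (StdForm.antidiagonal 2).over_mul_over K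
  have hmem : (A.map σ)ᵀ * Φ * A = Φ := by rw [← hΦ, ← hA]; exact g.2
  have hAu : Φ * (A.map σ)ᵀ * Φ * A = 1 := by rw [Matrix.mul_assoc Φ, Matrix.mul_assoc Φ, hmem, hΦΦ]
  -- scalars
  have hl₁ : l₁ ≠ 0 := fun h => by rw [h, mul_zero] at hswap; exact zero_ne_one hswap
  have hσl₀0 : σ l₀ ≠ 0 := fun h => by rw [h, zero_mul] at hswap; exact zero_ne_one hswap
  have hl₀ : l₀ ≠ 0 := fun h => hσl₀0 (by rw [h, map_zero])
  have hσt : σ t ≠ 0 := (map_ne_zero σ).2 ht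
  have hσl₀ : σ l₀ = l₁⁻¹ := eq_inv_of_mul_eq_one_left hswap
  have hσl₁ : σ l₁ = l₀⁻¹ := by
    have h := congrArg σ hswap
    rw [map_mul, hσ, map_one] at h
    exact eq_inv_of_mul_eq_one_right h
  set Δ : K := l₀ - l₁ with hΔ
  have hΔ0 : Δ ≠ 0 := sub_ne_zero.2 hne
  have hinvne : l₁⁻¹ - l₀⁻¹ ≠ 0 := sub_ne_zero.2 fun h => hne (inv_injective h).symm
  -- the idempotents
  obtain ⟨E₀, hE₀⟩ : ∃ E₀ : Matrix (Fin 2) (Fin 2) K, E₀ = Δ⁻¹ • (A - l₁ • (1 : Matrix (Fin 2) (Fin 2) K)) := ⟨_, rfl⟩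
  obtain ⟨E₁, hE₁⟩ : ∃ E₁ : Matrix (Fin 2) (Fin 2) K, E₁ = 1 - E₀ := ⟨_, rfl⟩
  have hCH : (A - l₁ • (1 : Matrix (Fin 2) (Fin 2) K)) * (A - l₀ • (1 : Matrix (Fin 2) (Fin 2) K)) = 0 :=
    sub_smul_one_mul_sub_smul_one_eq_zero A hroot hsum
  have hsplit : A - l₁ • (1 : Matrix (Fin 2) (Fin 2) K) = (A - l₀ • 1) + Δ • 1 := by rw [hΔ, sub_smul]; abel
  have hsq : (A - l₁ • (1 : Matrix (Fin 2) (Fin 2) K)) * (A - l₁ • 1) = Δ • (A - l₁ • 1) := by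
    calc (A - l₁ • (1 : Matrix (Fin 2) (Fin 2) K)) * (A - l₁ • 1) = (A - l₁ • 1) * ((A - l₀ • 1) + Δ • 1) := by rw [← hsplit]
      _ = (A - l₁ • 1) * (A - l₀ • 1) + Δ • (A - l₁ • 1) := by rw [Matrix.mul_add, Matrix.mul_smul, Matrix.mul_one]
      _ = Δ • (A - l₁ • 1) := by rw [hCH, zero_add]
  have hE₀sq : E₀ * E₀ = E₀ := by
    rw [hE₀, Matrix.smul_mul, Matrix.mul_smul, hsq, smul_smul, smul_smul, mul_assoc, inv_mul_cancel₀ hΔ0, mul_one]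
  have hE₀E₁ : E₀ * E₁ = 0 := by rw [hE₁, Matrix.mul_sub, Matrix.mul_one, hE₀sq, sub_self]
  have hE₁E₀ : E₁ * E₀ = 0 := by rw [hE₁, Matrix.sub_mul, Matrix.one_mul, hE₀sq, sub_self]
  have hE₁sq : E₁ * E₁ = E₁ := by rw [hE₁, Matrix.sub_mul, Matrix.one_mul, Matrix.mul_sub, Matrix.mul_one, hE₀sq, sub_self, sub_zero]
  have hsum₁ : E₀ + E₁ = 1 := by rw [hE₁, add_sub_cancel]
  have hΔE : Δ • E₀ = A - l₁ • 1 := by rw [hE₀, smul_smul, mul_inv_cancel₀ hΔ0, one_smul]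
  -- `A` commutes with `E₀`, `E₁`; `A E₀ = λ₀ E₀`, `A E₁ = λ₁ E₁`
  have hcomm : (A - l₁ • (1 : Matrix (Fin 2) (Fin 2) K)) * A = A * (A - l₁ • 1) := by
    rw [Matrix.sub_mul, Matrix.mul_sub, Matrix.smul_mul, Matrix.mul_smul, Matrix.one_mul, Matrix.mul_one]
  have hE₀A : E₀ * A = A * E₀ := by rw [hE₀, Matrix.smul_mul, Matrix.mul_smul, hcomm]
  have hE₁A : E₁ * A = A * E₁ := by rw [hE₁, Matrix.sub_mul, Matrix.mul_sub, Matrix.one_mul, Matrix.mul_one, hE₀A]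
  have hAE₀ : A * E₀ = l₀ • E₀ := by
    have h1 : A * (A - l₁ • (1 : Matrix (Fin 2) (Fin 2) K)) = l₀ • (A - l₁ • 1) := by
      rw [← hcomm]
      have h2 : (A - l₁ • (1 : Matrix (Fin 2) (Fin 2) K)) * (A - l₀ • 1) = (A - l₁ • 1) * A - l₀ • (A - l₁ • 1) := by
        rw [Matrix.mul_sub, Matrix.mul_smul, Matrix.mul_one]
      rw [h2] at hCH
      exact (sub_eq_zero.1 hCH)
    rw [hE₀, Matrix.mul_smul, h1, smul_comm]
  have hAE₁ : A * E₁ = l₁ • E₁ := by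
    have hAeq : A = Δ • E₀ + l₁ • 1 := (sub_eq_iff_eq_add.1 hΔE.symm)
    calc A * E₁ = A - A * E₀ := by rw [hE₁, Matrix.mul_sub, Matrix.mul_one]
      _ = Δ • E₀ + l₁ • 1 - l₀ • E₀ := by rw [hAE₀, ← hAeq]
      _ = l₁ • E₁ := by rw [hE₁, hΔ, sub_smul, smul_sub]; abel
  -- the inverse and the adjoint of `A`
  have hAB : A * (l₀⁻¹ • E₀ + l₁⁻¹ • E₁) = 1 := by
    rw [Matrix.mul_add, Matrix.mul_smul, Matrix.mul_smul, hAE₀, hAE₁, smul_smul, smul_smul, inv_mul_cancel₀ hl₀, inv_mul_cancel₀ hl₁, one_smul,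
      one_smul, hsum₁]
  have hadjA : Φ * (A.map σ)ᵀ * Φ = l₀⁻¹ • E₀ + l₁⁻¹ • E₁ := by
    calc Φ * (A.map σ)ᵀ * Φ = Φ * (A.map σ)ᵀ * Φ * (A * (l₀⁻¹ • E₀ + l₁⁻¹ • E₁)) := by rw [hAB, Matrix.mul_one]
      _ = Φ * (A.map σ)ᵀ * Φ * A * (l₀⁻¹ • E₀ + l₁⁻¹ • E₁) := by simp only [Matrix.mul_assoc]
      _ = l₀⁻¹ • E₀ + l₁⁻¹ • E₁ := by rw [hAu, Matrix.one_mul]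
  -- `E₀⋆ = E₁`, `E₁⋆ = E₀`
  have hadjE₀ : Φ * (E₀.map σ)ᵀ * Φ = E₁ := by
    have h1 : E₀ = Δ⁻¹ • (A + (-l₁) • (1 : Matrix (Fin 2) (Fin 2) K)) := by rw [hE₀, neg_smul, ← sub_eq_add_neg]
    rw [h1, adj_smul σ, adj_add σ, adj_smul σ, adj_one σ hΦΦ, hadjA, map_inv₀, hΔ, map_sub, hσl₀, hσl₁, map_neg, hσl₁]
    have h2 : (l₀⁻¹ • E₀ + l₁⁻¹ • E₁) + (-l₀⁻¹) • (1 : Matrix (Fin 2) (Fin 2) K) = (l₁⁻¹ - l₀⁻¹) • E₁ := by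
      rw [← hsum₁, smul_add, sub_smul, neg_smul, neg_smul]; abel
    rw [h2, smul_smul, inv_mul_cancel₀ hinvne, one_smul]
  have hadjE₁ : Φ * (E₁.map σ)ᵀ * Φ = E₀ := by
    have h1 : E₁ = 1 + (-1 : K) • E₀ := by rw [hE₁, neg_one_smul, ← sub_eq_add_neg]
    rw [h1, adj_add σ, adj_one σ hΦΦ, adj_smul σ, hadjE₀, map_neg, map_one, neg_one_smul, hE₁]
    abel
  -- the element `Y_t`
  obtain ⟨s, hs⟩ : ∃ s : K, s = (σ t)⁻¹ := ⟨_, rfl⟩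
  obtain ⟨Y, hY⟩ : ∃ Y : Matrix (Fin 2) (Fin 2) K, Y = t • E₀ + s • E₁ := ⟨_, rfl⟩
  have hσs : σ s * t = 1 := by rw [hs, map_inv₀, hσ, inv_mul_cancel₀ ht]
  have hts : σ t * s = 1 := by rw [hs, mul_inv_cancel₀ hσt]
  have hadjY : Φ * (Y.map σ)ᵀ * Φ = σ t • E₁ + σ s • E₀ := by
    rw [hY, adj_add σ, adj_smul σ, adj_smul σ, hadjE₀, hadjE₁]
  have hYY : Φ * (Y.map σ)ᵀ * Φ * Y = 1 := by
    rw [hadjY, hY]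
    simp only [Matrix.add_mul, Matrix.mul_add, Matrix.smul_mul, Matrix.mul_smul, hE₁E₀, hE₁sq, hE₀sq, hE₀E₁, smul_zero, zero_add, add_zero, smul_smul]
    rw [mul_comm s, mul_comm t, hts, hσs, one_smul, one_smul, ← hsum₁, add_comm]
  have hYY' : Y * (Φ * (Y.map σ)ᵀ * Φ) = 1 := mul_eq_one_comm.1 hYY
  let Yu : GL (Fin 2) K := ⟨Y, Φ * (Y.map σ)ᵀ * Φ, hYY', hYY⟩
  have hYmem : Yu ∈ unitaryGroupOfForm σ ((StdForm.antidiagonal 2).over K) := by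
    show (Y.map σ)ᵀ * (StdForm.antidiagonal 2).over K * Y = (StdForm.antidiagonal 2).over K
    rw [hΦ]
    calc (Y.map σ)ᵀ * Φ * Y = Φ * Φ * ((Y.map σ)ᵀ * Φ * Y) := by rw [hΦΦ, Matrix.one_mul]
      _ = Φ * (Φ * (Y.map σ)ᵀ * Φ * Y) := by simp only [Matrix.mul_assoc]
      _ = Φ := by rw [hYY, Matrix.mul_one]
  refine ⟨⟨Yu, hYmem⟩, ?_, ?_⟩
  · rw [Subgroup.mem_centralizer_iff]
    intro h hh
    rw [Set.mem_singleton_iff] at hh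
    rw [hh]
    apply Subtype.ext
    apply Units.ext
    show ((g : GL (Fin 2) K) : Matrix (Fin 2) (Fin 2) K) * Y = Y * ((g : GL (Fin 2) K) : Matrix (Fin 2) (Fin 2) K)
    rw [hA, hY, Matrix.mul_add, Matrix.add_mul, Matrix.mul_smul, Matrix.mul_smul, Matrix.smul_mul, Matrix.smul_mul, hE₀A, hE₁A]
  · show Y 0 0 = t * (Δ⁻¹ * (A 0 0 - l₁)) + (σ t)⁻¹ * (1 - Δ⁻¹ * (A 0 0 - l₁))
    rw [hY, hE₁, hE₀, ← hs]
    simp only [Matrix.add_apply, Matrix.smul_apply, Matrix.sub_apply, Matrix.one_apply_eq, smul_eq_mul, mul_one]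

end Torus

/-! ## §4 HEAD: the box lemma (letter COLL₂) -/

/-- **(FC-6₂) THE BOX LEMMA ON `U(σ, Φ₂)(K)`** — letter COLL₂ of the (SC-an)₂ assembly, the type of the binder `hCOLL` of ★ `K2E3SupercuspidalTruncatedCharAnalyticTwoOfLetters`
VERBATIM.  Let `K` be a non-archimedean local field with `Valued K ℤᵐ⁰`, `σ` an isometric involution, `ϖ` a uniformiser, `J = Φ₂`, and `g ∈ U(σ, Φ₂)(K)` with all entries of
valuation `≤ exp M` and `v(g₀₁) ≤ exp(M − 2d)` (i.e. `g ∈ Ω_M ∩ t_d Ω_M t_d⁻¹`), `5M + 4k + 2 ≤ d`.  If the centraliser `Z_U(g)` is COMPACT then the two diagonal entries are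
`exp(−k)`-close: `∃ i ≠ j, v(gᵢᵢ − gⱼⱼ) < exp(−k)`.  (If the diagonal were separated: §1 two `K`-rational eigenvalues near the diagonal, §2 the root involution swaps them, §3 the
split torus `{Y_t}` lies in `Z_U(g)`, and `v((Y_t)₀₀) = v(t)` is unbounded — against the entry bound on the compact `Z_U(g)` (★ F1₂ `exists_forall_mem_v_apply_le_exp`).)
[cite: Rogawski1990, §3.6 pp. 31–32] [cite: PlatonovRapinchuk1994, §3.3] [cite: NeukirchANT1999, Ch. II §4 Lemma (4.6)] [cite: HarishChandra1970, Part VI §8 p. 60] -/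
theorem exists_v_sub_lt_of_isCompact_centralizer :
    ∀ (K : Type) [Field K] [Valued K ℤᵐ⁰] [ValuativeRel K] [(Valued.v : Valuation K ℤᵐ⁰).Compatible] [IsNonarchimedeanLocalField K]
      (σ : K →+* K), (∀ x, σ (σ x) = x) → (∀ x, Valued.v (σ x) = Valued.v x) → ∀ {ϖ : K}, Valued.v ϖ = WithZero.exp (-1 : ℤ) →
      ∀ {J : Matrix (Fin 2) (Fin 2) K}, J = (StdForm.antidiagonal 2).over K →
      ∀ (M k d : ℕ), 5 * M + 4 * k + 2 ≤ d → ∀ g : ↥(unitaryGroupOfForm σ J),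
        (∀ i j, Valued.v (((g : GL (Fin 2) K) : Matrix (Fin 2) (Fin 2) K) i j) ≤ WithZero.exp (M : ℤ)) →
        Valued.v (((g : GL (Fin 2) K) : Matrix (Fin 2) (Fin 2) K) 0 1) ≤ WithZero.exp ((M : ℤ) - 2 * d) →
        IsCompact ((Subgroup.centralizer ({g} : Set ↥(unitaryGroupOfForm σ J))) : Set ↥(unitaryGroupOfForm σ J)) →
          ∃ i j : Fin 2, i ≠ j ∧ Valued.v (((g : GL (Fin 2) K) : Matrix (Fin 2) (Fin 2) K) i i - ((g : GL (Fin 2) K) : Matrix (Fin 2) (Fin 2) K) j j) < WithZero.exp (-(k : ℤ)) := by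
  intro K _ _ _ _ _ σ hσ hσv ϖ hϖ J hJ M k d hd g hall h01 hZ
  by_contra hcon
  -- the diagonal is separated
  have hsep : WithZero.exp (-(k : ℤ)) ≤
      Valued.v (((g : GL (Fin 2) K) : Matrix (Fin 2) (Fin 2) K) 0 0 - ((g : GL (Fin 2) K) : Matrix (Fin 2) (Fin 2) K) 1 1) :=
    not_lt.1 fun hlt => hcon ⟨0, 1, Fin.zero_ne_one, hlt⟩
  set a : K := ((g : GL (Fin 2) K) : Matrix (Fin 2) (Fin 2) K) 0 0 with ha
  set b : K := ((g : GL (Fin 2) K) : Matrix (Fin 2) (Fin 2) K) 0 1 with hb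
  set c : K := ((g : GL (Fin 2) K) : Matrix (Fin 2) (Fin 2) K) 1 0 with hc
  set e : K := ((g : GL (Fin 2) K) : Matrix (Fin 2) (Fin 2) K) 1 1 with he
  have hk0 : (0 : ℤᵐ⁰) < WithZero.exp (-(k : ℤ)) := WithZero.exp_pos
  have hvae0 : Valued.v (a - e) ≠ 0 := (hk0.trans_le hsep).ne'
  -- §1 the eigenvalue `λ₀` near `a`, `λ₁ := a + e − λ₀`
  obtain ⟨l₀, hroot, hl₀⟩ := exists_root_near_diagonal hϖ a b c e M k d (by omega) (hall 0 0) h01 (hall 1 0) (hall 1 1) hsep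
  set l₁ : K := a + e - l₀ with hl₁
  have hsum : l₀ + l₁ = a + e := by rw [hl₁]; ring
  have hsmall : Valued.v (l₀ - a) < Valued.v (a - e) :=
    lt_of_le_of_lt hl₀ (lt_of_lt_of_le (WithZero.exp_lt_exp.2 (by omega)) hsep)
  have hv2 : Valued.v (2 : K) ≤ 1 := by
    rw [show (2 : K) = 1 + 1 by norm_num]
    exact Valuation.map_add_le _ (by rw [map_one]) (by rw [map_one])
  have hvl₀e : Valued.v (l₀ - e) = Valued.v (a - e) := by
    rw [show l₀ - e = (l₀ - a) + (a - e) by ring]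
    exact Valuation.map_add_eq_of_lt_right _ hsmall
  have hvΔ : Valued.v (l₀ - l₁) = Valued.v (a - e) := by
    rw [show l₀ - l₁ = 2 * (l₀ - a) + (a - e) by rw [hl₁]; ring]
    refine Valuation.map_add_eq_of_lt_right _ (lt_of_le_of_lt ?_ hsmall)
    rw [map_mul]
    exact mul_le_of_le_one_left' hv2
  have hne : l₀ ≠ l₁ := fun h => hvae0 (by rw [← hvΔ, h, sub_self, map_zero])
  -- §2 the root involution swaps `λ₀`, `λ₁`
  obtain ⟨hT, hD⟩ := trace_det_rel σ hJ g
  have hU : Valued.v (σ e * a - 1) ≤ WithZero.exp (2 * (M : ℤ) - d) := by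
    have r10 := Two.rel10 σ hJ g
    rw [← ha, ← hb, ← hc, ← he] at r10
    rw [show σ e * a - 1 = -(σ b * c) by linear_combination r10, Valuation.map_neg, map_mul, hσv]
    calc Valued.v b * Valued.v c ≤ WithZero.exp ((M : ℤ) - 2 * d) * WithZero.exp (M : ℤ) := mul_le_mul' h01 (hall 1 0)
      _ ≤ WithZero.exp (2 * (M : ℤ) - d) := by rw [← WithZero.exp_add]; exact WithZero.exp_le_exp.2 (by omega)
  have hne1 : σ l₀ * l₀ ≠ 1 :=
    K2E3NearSingularOfCompactCentralizer.sigma_mul_ne_one_of_near_separated σ hσv hd (hall 0 0) (hall 1 1) hU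
      (hl₀.trans (WithZero.exp_le_exp.2 (by omega))) hsep
  have hswap : σ l₀ * l₁ = 1 := by
    have h := sigma_root_mul_root_cases σ hT hD hroot
    rw [← hl₁] at h
    exact sub_eq_zero.1 ((mul_eq_zero.1 h).resolve_left (sub_ne_zero.2 hne1))
  -- §3–§4 the torus beats the entry bound on the compact centraliser
  obtain ⟨M', hM'⟩ := K2E3FinConjCartanCoverTwo.exists_forall_mem_v_apply_le_exp σ J hϖ hZ
  obtain ⟨hvt, hϖpow⟩ := v_inv_pow_uniformizer hϖ (M' + 1)
  set t : K := (ϖ ^ (M' + 1))⁻¹ with htdef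
  have ht : t ≠ 0 := inv_ne_zero hϖpow
  obtain ⟨y, hyZ, hy00⟩ := exists_mem_centralizer_apply_zero_zero σ hσ hJ g hroot hsum hne hswap t ht
  have hbound := hM' y hyZ 0 0
  rw [hy00] at hbound
  -- `v((E₀)₀₀) = 1`, `v((E₁)₀₀) ≤ 1`
  have hE : Valued.v ((l₀ - l₁)⁻¹ * (a - l₁)) = 1 := by
    rw [show a - l₁ = l₀ - e by rw [hl₁]; ring, map_mul, map_inv₀, hvΔ, hvl₀e, inv_mul_cancel₀ hvae0]
  have hE' : Valued.v (1 - (l₀ - l₁)⁻¹ * (a - l₁)) ≤ 1 := by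
    rw [show 1 - (l₀ - l₁)⁻¹ * (a - l₁) = (l₀ - l₁)⁻¹ * (l₀ - a) by field_simp [sub_ne_zero.2 hne]; rw [hl₁]; ring, map_mul, map_inv₀, hvΔ]
    calc (Valued.v (a - e))⁻¹ * Valued.v (l₀ - a) ≤ (Valued.v (a - e))⁻¹ * Valued.v (a - e) := mul_le_mul' le_rfl hsmall.le
      _ = 1 := inv_mul_cancel₀ hvae0
  -- `v((Y_t)₀₀) = exp(M′+1)`
  have hvσt : Valued.v (σ t)⁻¹ = WithZero.exp (-((M' + 1 : ℕ) : ℤ)) := by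
    rw [map_inv₀, hσv, htdef, hvt, WithZero.exp_neg]
  have hbig : Valued.v (t * ((l₀ - l₁)⁻¹ * (a - l₁))) = WithZero.exp ((M' + 1 : ℕ) : ℤ) := by
    rw [map_mul, htdef, hvt, hE, mul_one]
  have hlow : Valued.v ((σ t)⁻¹ * (1 - (l₀ - l₁)⁻¹ * (a - l₁))) < Valued.v (t * ((l₀ - l₁)⁻¹ * (a - l₁))) := by
    rw [hbig, map_mul, hvσt]
    calc WithZero.exp (-((M' + 1 : ℕ) : ℤ)) * Valued.v (1 - (l₀ - l₁)⁻¹ * (a - l₁)) ≤ WithZero.exp (-((M' + 1 : ℕ) : ℤ)) * 1 := mul_le_mul' le_rfl hE'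
      _ < WithZero.exp ((M' + 1 : ℕ) : ℤ) := by rw [mul_one]; exact WithZero.exp_lt_exp.2 (by push_cast; omega)
  rw [Valuation.map_add_eq_of_lt_left _ hlow, hbig] at hbound
  have := WithZero.exp_le_exp.1 hbound
  push_cast at this
  omega

end Summit.HodgeConjecture.HodgeConjecture.Cruxes.H413.K2E3BoxCompactCentralizerCollisionTwo

end
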